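import Summits.MatrixMultiplication.MatrixMultiplication.Theses.LevelGradedCohnUmans
import Literature.NumberTheory.DiophantineGeometry.StandardFillings
import Literature.NumberTheory.DiophantineGeometry.PartitionTableauxProofs
import Literature.NumberTheory.DiophantineGeometry.SchurWeylPlethysmHwMultiplicityProofs
import Literature.RepresentationTheory.FiniteGroups.AldousOrderProofs
import Summits.MatrixMultiplication.MatrixMultiplication.Theorems.LevelTwoBeatsCubes.Negative.GradedNeumannCount

/-!
# Disproof of `SnLevelDesigns` — findings (crux stmt-MatrixMultiplication-7613, route `LevelGradedCohnUmans`)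

Standing-adversary work file (refuter, cdisprove mode; seat refuter-cdisprove-stmt-MatrixMultiplication-7613-0).
Crux (rank 4, planner-badged `open-problem`):
`∀ ε > 0 ∃ n k X Y Z ⊆ 𝔖ₙ`, `k`-token separated, with `∑_{μ₁ ≥ n-k} (f^μ)^{2+ε} < (|X||Y||Z|)^{(2+ε)/3}`.

UPDATE 2026-08-16T01:35Z: the sibling crux `LevelTwoBeatsCubes` (7612) is REFUTED for every `n`
(`Theorems/LevelGradedCohnUmansLevelTwoBeatsCubes_refuted`, graded Neumann count) and the route is
BROKEN (72 h repair grace).  For THIS crux the same count gives `V ≤ 0.385·(dim T_k)^{3/2}` at every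
level (`neumann_X`, `neumann_Z`, `volume_le_of_cubic_budget` below): each fixed level `k` dies for
`ε < ε_k` (`ε_2 ≈ 22.5`, `ε_3 = ∞`, `ε_4 ≈ 2.5`, …, `ε_14 ≈ 0.41`, `ε_k ≈ 6/k`), so a witness family needs
`k(ε) ≳ 6/ε → ∞`; the large-`k` window stays open (`ρ_k(ε) → 0`), hence still NO KILL.

VERDICT SO FAR: NO KILL, and no unconditional kill is available cheaply — at `k ≥ n - 1` the
token space is all of `ℂ^{𝔖ₙ}` and the budget is the full `∑_μ (f^μ)^{2+ε}`, so `¬SnLevelDesigns`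
contains "the symmetric groups cannot prove `ω = 2` via TPP subsets", an open problem
(BCCGU 2017 §5; only Young-SUBGROUP triples are excluded, `YoungSubgroupBarrier`).  A refutation
needs a level-uniform TOKEN BARRIER `Γ_k ≤ c_k(2+ε₀)` for one fixed `ε₀` and ALL `k ≤ n`; nothing of
the kind is in print (lit/negatives searched, see NOTES).  What this file establishes instead
(everything below is `sorry`-free, std axioms):

## Findings

RENDERING / JUNK AUDIT (all clean; the statement is calibrated exactly at its degenerate corners)
* `one_le_budget` — the budget is `≥ 1` for every `n, k` (the partition `(n)` always pays `1`).
* `not_at_of_card_le_one`, `not_at_of_le_one` — volume `≤ 1` (in particular `n ≤ 1`) never works.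
* `not_at_level_zero` — LEVEL 0 IS DEAD for every `ε`: constants separate only singletons
  (`card_mul_le_one_of_sep_zero`), budget `= 1 = ` volume, and `<` is strict.
* `budget_zero`, `numStandardTableaux_indiscrete` (`f^{(n)} = 1`, via the tree's Frobenius formula).
* `not_at_level_one` — LEVEL 1 IS DEAD for every `n` and every `0 < ε ≤ 1` (and for `n ≥ 3` every
  `ε > 0`, `not_at_level_one_of_three_le`): `f^{(n-1,1)} = n-1` (`numStandardTableaux_twoRow`,
  Frobenius formula, two rows) gives `budget ≥ 1 + (n-1)^{2+ε}` (`budget_one_ge`);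
  `dim T_1 ≤ (n-1)²+1` (`finrank_tokenSpace_one_le`: the entries `[g i = j]`, `i,j < n-1`, and `1`
  span); the three walls + INTEGRALITY (`mul_mul_le_cube_of_pairwise`) force `V ≤ (n-1)³`, so
  `V^{(2+ε)/3} ≤ (n-1)^{2+ε} < budget`.  The route's "level 1 is EMPTY" is now a theorem; any
  proof of the crux in the regime `ε ≤ 1` uses `k ≥ 2`.
* LOAD-BEARING: `exists_budget_lt_volPow` — drop separation ⇒ trivially TRUE (`n=2,k=0,X=𝔖₂`);
  `at_le_version_trivial` — replace `<` by `≤` ⇒ trivially TRUE (singletons, level 0, equality);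
  replace the graded budget by the full one ⇒ the open full-budget `𝔖ₙ` problem (no cheap verdict);
  large `ε` is trivial (prior refuter note: `n=2,k=1` works iff `ε > 1`), the content is `ε → 0`.

NECESSARY CONDITIONS ON ANY DESIGN (prover briefing; new items marked NEW)
* `quotXY_injOn`, `quotYZ_injOn`, `quotXZ_injOn` — separation ⇒ the three quotient maps are
  injective (the TPP shadow; cf. route item `SepImpliesTPP`).
* `tokenFn_translate` — two-sided translation invariance of the `k`-token space, with the explicit
  re-indexed coefficient table (the plumbing `TokenBudget`/`GradedDesignFamily` need).
* DIMENSION WALLS `card_X_mul_card_Y_le_finrank`, `card_Y_mul_card_Z_le_finrank`,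
  `card_X_mul_card_Z_le_finrank`, `volume_sq_le_finrank_cube`: `|X||Y|, |Y||Z|, |X||Z| ≤ dim T_k`
  hence `V² ≤ (dim T_k)³` — the separators and their one-sided translates are dual families
  (`linearIndependent_of_dualPoints`).  This is route item `TokenWall` minus the Schensted count
  `dim T_k = ∑_{μ₁≥n-k} (f^μ)²` (candidate-proof material for stmt-7616, not landed by me).
* NEW — SIGN ORTHOGONALITY `sum_sign_mul_tokenFn`: for `k + 2 ≤ n` every `k`-token functional is
  orthogonal to `sgn` (right-multiply the fibre `{g ∘ p = q}` by a transposition off `range p`).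
* NEW — COVERING WALL `exists_not_mem_quot`, `card_add_card_le_factorial`: for `k ≤ n-2` the
  quotient set `Q = X⁻¹YY⁻¹Z` never covers `𝔖ₙ` (else the separator is `δ_{x₀⁻¹z₀} ∉ sgn^⊥`), so
  `|X||Y| + |Y||Z| ≤ n!`; with `|X||Z| ≤ n!`: `four_mul_volume_sq_le`, `4V² ≤ (n!)³` — graded
  designs fill at most HALF the square-root packing bound at every level `k ≤ n-2`.  In the window
  arithmetic this is the operative wall for `k = n - O(1)` (where `dim T_k ≈ n!` says nothing):
  e.g. level `n-2` needs `V > (n!-1)^{3/(2+ε)}` but has `V < (n!)^{3/2}/2`, dead for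
  `ε ≲ 0.9/log n!` — so the near-full levels die one by one as `ε → 0`, but NOT uniformly.
* NEW — COSET OBSTRUCTION `exists_coset_point_not_mem_quot` (engine `sum_coset_sign_mul_tokenFn`,
  pigeonhole `exists_pair_disjoint_range`): for `K = ⟨k+1 disjoint transpositions⟩ ≅ (ℤ/2)^{k+1}` and
  every target, the coset `x₀⁻¹z₀K ⊄ Q`; so `X`, `Z` contain no left coset of a conjugate of `K` and
  `YY⁻¹ ⊉ K'` — the sharpest local certificate (support `2^{k+1}`), see GENERAL FORM.
* LANDED under `Theorems/SnLevelDesigns/Negative/` (all sorry-free, std axioms): `DeadCorners.lean`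
  (p73814), `CoveringWall.lean` (p73584), `DimensionWalls.lean` (p73803), `LevelOne.lean` (p81973),
  `CosetObstruction.lean` (p81934), `NeumannLevelK.lean` (p75390) — importable by ideators/planners.
* GENERAL FORM of the obstruction (paper, guides the computations): separation at target
  `(x₀,z₀)` fails iff some `h ∈ T_k^⊥ = ⊕_{μ₁ < n-k} U_μ = sgn · span{1_C : C a block coset with
  ≤ n-k-1 blocks}` has `supp h ⊆ Q` and `h(x₀⁻¹z₀) ≠ 0`; `Q` does not depend on the target, so
  SEPARATED ⇔ TPP' ∧ (X⁻¹Z) ∩ U_k(Q) = ∅ with `U_k(Q)` = union of supports of `T_k^⊥ ∩ ℂ^Q`.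
  Smallest certificates: `h = sgn·1_{gK}`, `K = ⟨k+1 disjoint transpositions⟩ ≅ (ℤ/2)^{k+1}`
  (`n ≥ 2k+2`): a level-`k` design has NO coset `gK ⊆ Q` through a point of `X⁻¹Z`.

COMPUTATIONS (scripts `compute/levelsep*.py` = SAT+CEGAR exact search with Young-subgroup and `(ℤ/2)^{k+1}`
coset cores, `compute/greedy_sep.py` = random greedy lower bounds, `compute/subgroup_triples.py`,
`compute/agl_thin*.py`; kit jobs j007945 (n=4 exact), j009442/j014242 (AGL₁(7)), j014516 (Γ₂(5));
j008161/2/7 cancelled as moot after the sibling refutation, j008165/j008166 timed out undecided)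
* `n = 4, k = 2`: max 2-separated volume = 36 = max TPP volume (C₃, C₄, C₃ subgroups; prior
  refuter g41-1's exhaustive TPP max 36; EXACT by SAT+CEGAR, kit j007945: all 13 profiles above 36
  UNSAT, (3,4,3) SAT in 10 s — pipeline validated), threshold `B₃(4)+1 = 64`: EMPTY.
* `n = 5`: walls+covering alone leave for `LevelTwoBeatsCubes` (V ≥ 407, level 2) only the profiles
  `|Y| ∈ {6,7,8}`, `|X|+|Z| ≤ 120/|Y|`, `V ≤ 504`; level 3 (V ≥ 596) only `(|X|,|Y|,|Z|) = (10,6,10)`.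
  Lower bounds: best SUBGROUP triples (all 156 subgroups of S₅, `compute/subgroup_triples.py`):
  TPP max 256 (4,8,8); level-2-separated max 120 (5,4,6); level-3-separated max 256 (8,4,8);
  random greedy on subsets: level 2 `V ≥ 108`, level 3 `V ≥ 225`.  Thresholds 407 / 596: far
  (and now moot: the sibling refutation gives `V ≤ 325` at `n = 5`, level 2, for every triple;
  exact `Γ₂(5) ∈ [120, 325]`, SAT range search j014516 running at writing).
* PLANNER'S NAMED FAMILY AT `d = 1` (thinned conjugates of `AGL_1(7) < S_7`, level `k = 2`;
  `compute/agl_thin.py`, `agl_thin_v2.py`; kit j009442, j014242): hosts `H₁, H₂, H₃` = three of the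
  120 conjugates of `AGL_1(7)` (order 42; pairwise intersections of order 1, 2, 3 or 6), subsets
  `X ⊆ H₁, Y ⊆ H₂, Z ⊆ H₃` by SAT with TPP' encoded through the quotient sets inside the hosts.
  TPP'-ONLY thinnings of uniform size `s = 18` exist (60 host triples: `s_tpp = 18` for intersection
  pattern (2,2,2), typically 14), i.e. volume 5832 — ABOVE the level-2 graded Neumann cap
  `max_p (458p + p² - p³) = 3926` at `n = 7`, so for this family SEPARATION, not TPP, binds; and with
  2-separation enforced (v2: sizes `s = 15, 14, …, 8`, `(ℤ/2)³`-coset cores from `CosetObstruction`,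
  29 000 cores learned over 12 host triples) NO 2-separated thinning with `min(|X|,|Y|,|Z|) ≥ 8`
  (`V ≥ 512`) was found within the per-size budgets (400 CEGAR rounds / 300 s) — evidence, not
  proof, that thinned `AGL_1(q)`-conjugate triples sit far below even the (dead) level-2 window; the
  coset obstruction is the operative constraint.  (`d ≥ 2`, `k = d+1 ≥ 3`, `n = q^d ≥ 8`: not run.)

LITERATURE (zbMATH, 2026-08-16; local searchd/OpenAlex/S2/arXiv unavailable or rate-limited this session):
* P. M. Neumann, *A note on the triple product property for subsets of finite groups*, LMS J. Comput.
  Math. 14 (2011) 232–237 (doi:10.1112/s1461157010000288) — Lemma (quoted as Hedtke–Murthy 2012,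
  Lemma 2.11): TPP ⇒ `|S|(|T|+|U|-1) ≤ |G|` and cyclically; the printed, full-budget ancestor of the
  graded count `|X|(|Z|+|Y|-1) ≤ dim J` used above (the `Y`-version does not grade: its proof counts
  elements, not separating functions).
* I. Hedtke, S. Murthy, *Search and test algorithms for triple product property triples*, Groups
  Complex. Cryptol. 4 (2012) (arXiv:1104.5097) §7: subset capacities `β(G)` computed only for
  |G| ≤ 24 (8 h per group of order 24); no printed value for `S₅`; our `S₄` value 36 is consistent.
* No printed 'token-level' / graded Cohn–Umans negative result exists (route novelty note; BCCGU 2017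
  §5 poses the full-budget `S_n` question as open).

WHY IT RESISTS (one line each)
* contains the open full-budget `𝔖ₙ` problem at `k ≥ n-1`;
* for fixed `k` the dimension wall `V ≤ D_k^{3/2}` sits exactly at the `ε → 0` threshold (window
  `Γ_k ∈ (c_k(2+ε), c_k(2)]` is non-empty for every `k ≥ 2`), so counting alone cannot kill;
* the covering/sign obstructions kill each near-full level only below an `n`-dependent `ε`.

NEXT (targets for later cycles / the lead's stubs): exact `Γ₂(5), Γ₂(6)` from the SAT jobs; the
`(ℤ/2)^{k+1}`-coset obstruction as a Lean lemma; level 2 at small `n` by the same integrality route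
(needs `dim T_2 = D₂(n)` and the four hook values).
-/

set_option linter.dupNamespace false

namespace Summit.MatrixMultiplication.MatrixMultiplication.Cruxes.SnLevelDesigns.Disproof

open scoped BigOperators
open Summit.MatrixMultiplication.MatrixMultiplication.Theses.LevelGradedCohnUmans
open Literature.NumberTheory.DiophantineGeometry (numStandardTableaux numStandardTableaux_pos_holds)

noncomputable section

/-- `k`-token separation of a triple `X, Y, Z ⊆ 𝔖ₙ`, verbatim the first conjunct of the crux. -/
def Sep (n k : ℕ) (X Y Z : Finset (Equiv.Perm (Fin n))) : Prop :=
  ∀ x₀ ∈ X, ∀ z₀ ∈ Z, ∃ c : (Fin k → Fin n) → (Fin k → Fin n) → ℂ, ∀ x ∈ X, ∀ y ∈ Y, ∀ y' ∈ Y,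
    ∀ z ∈ Z, (∑ p : Fin k → Fin n, c p (⇑(x⁻¹ * y * y'⁻¹ * z) ∘ p)) =
      if x = x₀ ∧ y = y' ∧ z = z₀ then 1 else 0

/-- The graded budget `∑_{μ ⊢ n, μ₁ ≥ n-k} (f^μ)^{2+ε}`, verbatim the left side of the crux inequality. -/
def budget (n k : ℕ) (ε : ℝ) : ℝ :=
  ∑ μ : Nat.Partition n, if n - k ≤ μ.parts.sup then (numStandardTableaux μ : ℝ) ^ (2 + ε) else 0

/-- The volume side `(|X||Y||Z|)^{(2+ε)/3}`. -/
def volPow (ε : ℝ) {n : ℕ} (X Y Z : Finset (Equiv.Perm (Fin n))) : ℝ :=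
  ((X.card * Y.card * Z.card : ℕ) : ℝ) ^ ((2 + ε) / 3)

/-- One instance of the crux at fixed `ε, n, k, X, Y, Z`. -/
def At (ε : ℝ) (n k : ℕ) (X Y Z : Finset (Equiv.Perm (Fin n))) : Prop :=
  Sep n k X Y Z ∧ budget n k ε < volPow ε X Y Z

/-- The crux, restated through `At` (definitional). -/
theorem snLevelDesigns_iff :
    SnLevelDesigns ↔ ∀ ε : ℝ, 0 < ε → ∃ (n k : ℕ) (X Y Z : Finset (Equiv.Perm (Fin n))),
      At ε n k X Y Z :=
  Iff.rfl

/-! ## The budget is never below 1 (the trivial partition `(n)` always pays `1^{2+ε}`) -/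

theorem indiscrete_sup_ge (n k : ℕ) : n - k ≤ (Nat.Partition.indiscrete n).parts.sup := by
  rcases Nat.eq_zero_or_pos n with rfl | hn
  · simp
  · rw [Nat.Partition.indiscrete_parts hn.ne', Multiset.sup_singleton]
    exact Nat.sub_le n k

theorem one_le_budget (n k : ℕ) {ε : ℝ} (hε : 0 ≤ 2 + ε) : 1 ≤ budget n k ε := by
  unfold budget
  have hterm : (1 : ℝ) ≤ (if n - k ≤ (Nat.Partition.indiscrete n).parts.sup then
      (numStandardTableaux (Nat.Partition.indiscrete n) : ℝ) ^ (2 + ε) else 0) := by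
    rw [if_pos (indiscrete_sup_ge n k)]
    have h1 : (1 : ℝ) ≤ (numStandardTableaux (Nat.Partition.indiscrete n) : ℝ) := by
      exact_mod_cast numStandardTableaux_pos_holds (Nat.Partition.indiscrete n)
    exact Real.one_le_rpow h1 hε
  refine hterm.trans ?_
  refine Finset.single_le_sum (f := fun μ : Nat.Partition n =>
      if n - k ≤ μ.parts.sup then (numStandardTableaux μ : ℝ) ^ (2 + ε) else 0) ?_
    (Finset.mem_univ _)
  intro μ _
  split_ifs
  · positivity
  · exact le_rfl

/-! ## Small volume kills every instance -/

theorem not_at_of_card_le_one {ε : ℝ} (hε : 0 < ε) {n k : ℕ} {X Y Z : Finset (Equiv.Perm (Fin n))}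
    (hV : X.card * Y.card * Z.card ≤ 1) : ¬ At ε n k X Y Z := by
  rintro ⟨-, hlt⟩
  have h1 : volPow ε X Y Z ≤ 1 := by
    unfold volPow
    apply Real.rpow_le_one (by positivity) (by exact_mod_cast hV) (by positivity)
  have h2 := one_le_budget n k (by positivity : (0 : ℝ) ≤ 2 + ε)
  linarith

/-! ## Level `k = 0` is dead for every `ε` (constants separate only singletons) -/

theorem card_mul_le_one_of_sep_zero {n : ℕ} {X Y Z : Finset (Equiv.Perm (Fin n))}
    (h : Sep n 0 X Y Z) : X.card * Y.card * Z.card ≤ 1 := by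
  classical
  by_cases hX : X = ∅
  · simp [hX]
  by_cases hY : Y = ∅
  · simp [hY]
  by_cases hZ : Z = ∅
  · simp [hZ]
  obtain ⟨x₀, hx₀⟩ := Finset.nonempty_iff_ne_empty.mpr hX
  obtain ⟨y₀, hy₀⟩ := Finset.nonempty_iff_ne_empty.mpr hY
  obtain ⟨z₀, hz₀⟩ := Finset.nonempty_iff_ne_empty.mpr hZ
  obtain ⟨c, hc⟩ := h x₀ hx₀ z₀ hz₀
  -- the test functional is the constant `K`
  have hconst : ∀ g : Equiv.Perm (Fin n),
      (∑ p : Fin 0 → Fin n, c p (⇑g ∘ p)) = c default default := by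
    intro g
    rw [Fintype.sum_unique]
    congr 1
    exact Subsingleton.elim _ _
  have h1 : c default default = 1 := by
    have := hc x₀ hx₀ y₀ hy₀ y₀ hy₀ z₀ hz₀
    rw [hconst, if_pos ⟨rfl, rfl, rfl⟩] at this
    exact this
  have hXs : X ⊆ {x₀} := by
    intro x hx
    rw [Finset.mem_singleton]
    by_contra hne
    have := hc x hx y₀ hy₀ y₀ hy₀ z₀ hz₀
    rw [hconst, if_neg (fun h => hne h.1), h1] at this
    exact one_ne_zero this
  have hYs : Y ⊆ {y₀} := by
    intro y hy
    rw [Finset.mem_singleton]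
    by_contra hne
    have := hc x₀ hx₀ y hy y₀ hy₀ z₀ hz₀
    rw [hconst, if_neg (fun h => hne h.2.1), h1] at this
    exact one_ne_zero this
  have hZs : Z ⊆ {z₀} := by
    intro z hz
    rw [Finset.mem_singleton]
    by_contra hne
    have := hc x₀ hx₀ y₀ hy₀ y₀ hy₀ z hz
    rw [hconst, if_neg (fun h => hne h.2.2), h1] at this
    exact one_ne_zero this
  have := Finset.card_le_card hXs
  have := Finset.card_le_card hYs
  have := Finset.card_le_card hZs
  simp only [Finset.card_singleton] at *
  calc X.card * Y.card * Z.card ≤ 1 * 1 * 1 := by gcongr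
    _ = 1 := by norm_num

/-- **Level 0 is dead for every `ε > 0`**: any proof of the crux must use `k ≥ 1`
(indeed `k ≥ 2`, see `not_at_level_one`). -/
theorem not_at_level_zero {ε : ℝ} (hε : 0 < ε) (n : ℕ) (X Y Z : Finset (Equiv.Perm (Fin n))) :
    ¬ At ε n 0 X Y Z := fun h =>
  not_at_of_card_le_one hε (card_mul_le_one_of_sep_zero h.1) h

/-- **`n ≤ 1` is dead** (the group is trivial, the volume is at most 1, the budget at least 1). -/
theorem not_at_of_le_one {ε : ℝ} (hε : 0 < ε) {n : ℕ} (hn : n ≤ 1) (k : ℕ)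
    (X Y Z : Finset (Equiv.Perm (Fin n))) : ¬ At ε n k X Y Z := by
  have hsub : Subsingleton (Equiv.Perm (Fin n)) := by
    have : Subsingleton (Fin n) := by
      rcases Nat.le_one_iff_eq_zero_or_eq_one.mp hn with rfl | rfl <;> infer_instance
    infer_instance
  have hc : ∀ W : Finset (Equiv.Perm (Fin n)), W.card ≤ 1 := fun W =>
    Finset.card_le_one.mpr fun a _ b _ => Subsingleton.elim a b
  refine not_at_of_card_le_one hε ?_
  calc X.card * Y.card * Z.card ≤ 1 * 1 * 1 := by gcongr <;> exact hc _
    _ = 1 := by norm_num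


/-! ## The token functional, translation invariance, and orthogonality to the sign character -/

/-- The `k`-token test functional with coefficient table `c`: `g ↦ ∑_{p : [k] → [n]} c p (g ∘ p)`. -/
def tokenFn {n k : ℕ} (c : (Fin k → Fin n) → (Fin k → Fin n) → ℂ) (g : Equiv.Perm (Fin n)) : ℂ :=
  ∑ p : Fin k → Fin n, c p (⇑g ∘ p)

theorem sep_iff_tokenFn {n k : ℕ} {X Y Z : Finset (Equiv.Perm (Fin n))} :
    Sep n k X Y Z ↔ ∀ x₀ ∈ X, ∀ z₀ ∈ Z, ∃ c : (Fin k → Fin n) → (Fin k → Fin n) → ℂ,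
      ∀ x ∈ X, ∀ y ∈ Y, ∀ y' ∈ Y, ∀ z ∈ Z,
        tokenFn c (x⁻¹ * y * y'⁻¹ * z) = if x = x₀ ∧ y = y' ∧ z = z₀ then 1 else 0 :=
  Iff.rfl

/-- Two-sided translation invariance of the token space: `g ↦ f(a g b)` is again a `k`-token
functional, with the re-indexed table `c' p q = c (b⁻¹ ∘ p) (a ∘ q)`. -/
theorem tokenFn_translate {n k : ℕ} (c : (Fin k → Fin n) → (Fin k → Fin n) → ℂ)
    (a b g : Equiv.Perm (Fin n)) :
    tokenFn c (a * g * b) = tokenFn (fun p q => c (⇑b⁻¹ ∘ p) (⇑a ∘ q)) g := by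
  unfold tokenFn
  -- reindex `p ↦ b ∘ p` on the right-hand side
  let e : (Fin k → Fin n) ≃ (Fin k → Fin n) := Equiv.arrowCongr (Equiv.refl (Fin k)) b
  symm
  rw [← e.sum_comp]
  refine Finset.sum_congr rfl fun p _ => ?_
  have h1 : (⇑b⁻¹ ∘ (e p) : Fin k → Fin n) = p := by
    funext i; simp [e, Equiv.arrowCongr_apply, Equiv.Perm.inv_def]
  have h2 : (⇑a ∘ (⇑g ∘ e p) : Fin k → Fin n) = ⇑(a * g * b) ∘ p := by
    funext i; simp [e, Equiv.arrowCongr_apply]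
  simp only [h1, h2]

/-- For `k + 2 ≤ n` every `k`-token functional is orthogonal to the sign character: the fibre
`{g : g ∘ p = q}` is stable under right multiplication by a transposition of two points outside
the range of `p`, which flips the sign. -/
theorem sum_sign_mul_tokenFn {n k : ℕ} (hk : k + 2 ≤ n)
    (c : (Fin k → Fin n) → (Fin k → Fin n) → ℂ) :
    ∑ g : Equiv.Perm (Fin n), ((Equiv.Perm.sign g : ℤ) : ℂ) * tokenFn c g = 0 := by
  classical
  unfold tokenFn
  simp_rw [Finset.mul_sum]
  rw [Finset.sum_comm]
  refine Finset.sum_eq_zero fun p _ => ?_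
  -- two points outside the range of `p`
  have hcard : 2 ≤ ((Finset.univ.image p)ᶜ).card := by
    rw [Finset.card_compl, Fintype.card_fin]
    have : (Finset.univ.image p).card ≤ k := by
      calc (Finset.univ.image p).card ≤ (Finset.univ : Finset (Fin k)).card := Finset.card_image_le
        _ = k := by simp
    omega
  obtain ⟨a, ha, b, hb, hab⟩ := Finset.one_lt_card.mp hcard
  have hpa : ∀ i, p i ≠ a := fun i h => by
    have : a ∈ Finset.univ.image p := Finset.mem_image.mpr ⟨i, Finset.mem_univ _, h⟩
    exact (Finset.mem_compl.mp ha) this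
  have hpb : ∀ i, p i ≠ b := fun i h => by
    have : b ∈ Finset.univ.image p := Finset.mem_image.mpr ⟨i, Finset.mem_univ _, h⟩
    exact (Finset.mem_compl.mp hb) this
  set τ : Equiv.Perm (Fin n) := Equiv.swap a b with hτ
  set F : Equiv.Perm (Fin n) → ℂ := fun g => ((Equiv.Perm.sign g : ℤ) : ℂ) * c p (⇑g ∘ p) with hF
  have hreindex : ∑ g, F g = ∑ g, F (g * τ) :=
    (Fintype.sum_equiv (Equiv.mulRight τ) (fun g => F (g * τ)) F (fun g => rfl)).symm
  have hflip : ∀ g, F (g * τ) = - F g := by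
    intro g
    have hcomp : (⇑(g * τ) ∘ p : Fin k → Fin n) = ⇑g ∘ p := by
      funext i
      simp [hτ, Equiv.swap_apply_of_ne_of_ne (hpa i) (hpb i)]
    have hsign : ((Equiv.Perm.sign (g * τ) : ℤ) : ℂ) = - ((Equiv.Perm.sign g : ℤ) : ℂ) := by
      rw [Equiv.Perm.sign_mul, hτ, Equiv.Perm.sign_swap hab]
      push_cast
      ring
    simp only [hF, hcomp, hsign, neg_mul]
  have : ∑ g, F g = - ∑ g, F g := by
    conv_lhs => rw [hreindex]
    rw [← Finset.sum_neg_distrib]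
    exact Finset.sum_congr rfl fun g _ => hflip g
  have h0 : ∑ g, F g = 0 := by
    have h2 : (2 : ℂ) * ∑ g, F g = 0 := by rw [two_mul]; nth_rewrite 1 [this]; ring
    exact (mul_eq_zero.mp h2).resolve_left two_ne_zero
  simpa [hF] using h0

/-! ## Covering wall: at level `k ≤ n - 2` the quotient set `X⁻¹ Y Y⁻¹ Z` never covers `𝔖ₙ`

Otherwise the separator of a target `(x₀, z₀)` would be the delta function at `x₀⁻¹ z₀`, which is
not orthogonal to the sign character.  Consequence (`card_add_card_le_factorial`):
`|X||Y| + |Y||Z| ≤ n!` — the operative wall in the near-full regime `k = n - O(1)`, where the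
dimension wall `|X||Y| ≤ dim V_k ≈ n!` is vacuous; together with `|X||Z| ≤ n!` it gives
`|X||Y||Z| < (n!)^{3/2} / 2` for every level `k ≤ n - 2`. -/

theorem exists_not_mem_quot {n k : ℕ} {X Y Z : Finset (Equiv.Perm (Fin n))} (h : Sep n k X Y Z)
    (hk : k + 2 ≤ n) {x₀ : Equiv.Perm (Fin n)} (hx₀ : x₀ ∈ X) {z₀ : Equiv.Perm (Fin n)}
    (hz₀ : z₀ ∈ Z) :
    ∃ g : Equiv.Perm (Fin n), ∀ x ∈ X, ∀ y ∈ Y, ∀ y' ∈ Y, ∀ z ∈ Z, x⁻¹ * y * y'⁻¹ * z ≠ g := by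
  classical
  by_contra hall
  push Not at hall
  obtain ⟨c, hc⟩ := h x₀ hx₀ z₀ hz₀
  have hf : ∀ g, tokenFn c g = if g = x₀⁻¹ * z₀ then 1 else 0 := by
    intro g
    obtain ⟨x, hx, y, hy, y', hy', z, hz, hg⟩ := hall g
    have hval := hc x hx y hy y' hy' z hz
    change tokenFn c (x⁻¹ * y * y'⁻¹ * z) = _ at hval
    rw [hg] at hval
    rw [hval]
    by_cases hcond : x = x₀ ∧ y = y' ∧ z = z₀
    · obtain ⟨rfl, rfl, rfl⟩ := hcond
      rw [if_pos ⟨rfl, rfl, rfl⟩, if_pos]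
      rw [← hg]; group
    · rw [if_neg hcond]
      by_cases hg0 : g = x₀⁻¹ * z₀
      · -- then the target quadruple `(x₀, y, y, z₀)` also produces `g`, value 1 ≠ 0: use it
        have hval' := hc x₀ hx₀ y hy y hy z₀ hz₀
        change tokenFn c (x₀⁻¹ * y * y⁻¹ * z₀) = _ at hval'
        rw [if_pos ⟨rfl, rfl, rfl⟩] at hval'
        have : x₀⁻¹ * y * y⁻¹ * z₀ = g := by rw [hg0]; group
        rw [this, hval, if_neg hcond] at hval'
        exact absurd hval' zero_ne_one
      · rw [if_neg hg0]
  have hsum := sum_sign_mul_tokenFn hk c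
  simp_rw [hf, mul_ite, mul_one, mul_zero, Finset.sum_ite_eq', Finset.mem_univ, if_true] at hsum
  have hunit : ((Equiv.Perm.sign (x₀⁻¹ * z₀) : ℤ) : ℂ) ≠ 0 := by
    rcases Int.units_eq_one_or (Equiv.Perm.sign (x₀⁻¹ * z₀)) with h1 | h1 <;> simp [h1]
  exact hunit hsum

/-- TPP-injectivity of `(x, y) ↦ x⁻¹ y` on `X × Y` (from separation, `Z ≠ ∅`). -/
theorem quotXY_injOn {n k : ℕ} {X Y Z : Finset (Equiv.Perm (Fin n))} (h : Sep n k X Y Z)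
    (hZ : Z.Nonempty) :
    Set.InjOn (fun q : Equiv.Perm (Fin n) × Equiv.Perm (Fin n) => q.1⁻¹ * q.2)
      ((X ×ˢ Y : Finset _) : Set (Equiv.Perm (Fin n) × Equiv.Perm (Fin n))) := by
  classical
  obtain ⟨z₀, hz₀⟩ := hZ
  rintro ⟨x, y⟩ hxy ⟨x₁, y₁⟩ hxy₁ heq
  simp only [Finset.coe_product, Set.mem_prod, Finset.mem_coe] at hxy hxy₁
  simp only at heq
  obtain ⟨c, hc⟩ := h x hxy.1 z₀ hz₀
  have h1 := hc x₁ hxy₁.1 y₁ hxy₁.2 y hxy.2 z₀ hz₀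
  have h0 := hc x hxy.1 y hxy.2 y hxy.2 z₀ hz₀
  rw [if_pos ⟨rfl, rfl, rfl⟩] at h0
  have : x₁⁻¹ * y₁ * y⁻¹ * z₀ = x⁻¹ * y * y⁻¹ * z₀ := by rw [← heq]
  rw [this, h0] at h1
  by_cases hcond : x₁ = x ∧ y₁ = y ∧ z₀ = z₀
  · exact Prod.ext hcond.1.symm hcond.2.1.symm
  · rw [if_neg hcond] at h1; exact absurd h1 one_ne_zero

/-- TPP-injectivity of `(y', z) ↦ y'⁻¹ z` on `Y × Z` (from separation, `X ≠ ∅`). -/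
theorem quotYZ_injOn {n k : ℕ} {X Y Z : Finset (Equiv.Perm (Fin n))} (h : Sep n k X Y Z)
    (hX : X.Nonempty) :
    Set.InjOn (fun q : Equiv.Perm (Fin n) × Equiv.Perm (Fin n) => q.1⁻¹ * q.2)
      ((Y ×ˢ Z : Finset _) : Set (Equiv.Perm (Fin n) × Equiv.Perm (Fin n))) := by
  classical
  obtain ⟨x₀, hx₀⟩ := hX
  rintro ⟨y', z⟩ hyz ⟨y₁, z₁⟩ hyz₁ heq
  simp only [Finset.coe_product, Set.mem_prod, Finset.mem_coe] at hyz hyz₁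
  simp only at heq
  obtain ⟨c, hc⟩ := h x₀ hx₀ z hyz.2
  have h0 := hc x₀ hx₀ y' hyz.1 y' hyz.1 z hyz.2
  rw [if_pos ⟨rfl, rfl, rfl⟩] at h0
  have h1 := hc x₀ hx₀ y' hyz.1 y₁ hyz₁.1 z₁ hyz₁.2
  have : x₀⁻¹ * y' * y₁⁻¹ * z₁ = x₀⁻¹ * y' * y'⁻¹ * z := by
    rw [mul_assoc, mul_assoc, ← heq]; group
  rw [this, h0] at h1
  by_cases hcond : x₀ = x₀ ∧ y' = y₁ ∧ z₁ = z
  · exact Prod.ext hcond.2.1 hcond.2.2.symm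
  · rw [if_neg hcond] at h1; exact absurd h1 one_ne_zero

/-- **Covering wall.** For a `k`-token separated triple with `k + 2 ≤ n` and `X, Z ≠ ∅`:
`|X|·|Y| + |Y|·|Z| ≤ n!`. -/
theorem card_add_card_le_factorial {n k : ℕ} {X Y Z : Finset (Equiv.Perm (Fin n))}
    (h : Sep n k X Y Z) (hk : k + 2 ≤ n) (hX : X.Nonempty) (hZ : Z.Nonempty) :
    X.card * Y.card + Y.card * Z.card ≤ n.factorial := by
  classical
  obtain ⟨x₀, hx₀⟩ := hX
  obtain ⟨z₀, hz₀⟩ := id hZ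
  obtain ⟨g, hg⟩ := exists_not_mem_quot h hk hx₀ hz₀
  let qf : Equiv.Perm (Fin n) × Equiv.Perm (Fin n) → Equiv.Perm (Fin n) := fun q => q.1⁻¹ * q.2
  set A := (X ×ˢ Y).image qf with hA
  set B := (Y ×ˢ Z).image qf with hB
  have hAc : A.card = X.card * Y.card := by
    rw [hA, Finset.card_image_of_injOn (quotXY_injOn h hZ), Finset.card_product]
  have hBc : B.card = Y.card * Z.card := by
    rw [hB, Finset.card_image_of_injOn (quotYZ_injOn h ⟨x₀, hx₀⟩), Finset.card_product]
  set A' := A.image (fun a => a⁻¹ * g) with hA'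
  have hA'c : A'.card = A.card := by
    rw [hA']
    exact Finset.card_image_of_injective _ (fun a₁ a₂ h12 => by simpa using h12)
  have hdisj : Disjoint A' B := by
    rw [Finset.disjoint_left]
    intro w hwA hwB
    rw [hA', Finset.mem_image] at hwA
    obtain ⟨a, haA, rfl⟩ := hwA
    rw [hA, Finset.mem_image] at haA
    obtain ⟨⟨x, y⟩, hxy, rfl⟩ := haA
    rw [hB, Finset.mem_image] at hwB
    obtain ⟨⟨y', z⟩, hyz, hw⟩ := hwB
    simp only [Finset.mem_product] at hxy hyz
    apply hg x hxy.1 y hxy.2 y' hyz.1 z hyz.2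
    simp only [qf] at hw
    calc x⁻¹ * y * y'⁻¹ * z = (x⁻¹ * y) * (y'⁻¹ * z) := by group
      _ = (x⁻¹ * y) * ((x⁻¹ * y)⁻¹ * g) := by rw [hw]
      _ = g := by group
  have hle : (A' ∪ B).card ≤ (Finset.univ : Finset (Equiv.Perm (Fin n))).card :=
    Finset.card_le_card (Finset.subset_univ _)
  rw [Finset.card_union_of_disjoint hdisj, Finset.card_univ, Fintype.card_perm, Fintype.card_fin,
    hA'c, hAc, hBc] at hle
  exact hle


/-- `(x, z) ↦ x⁻¹ z` is injective on `X × Z` (from separation, `Y ≠ ∅`). -/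
theorem quotXZ_injOn {n k : ℕ} {X Y Z : Finset (Equiv.Perm (Fin n))} (h : Sep n k X Y Z)
    (hY : Y.Nonempty) :
    Set.InjOn (fun q : Equiv.Perm (Fin n) × Equiv.Perm (Fin n) => q.1⁻¹ * q.2)
      ((X ×ˢ Z : Finset _) : Set (Equiv.Perm (Fin n) × Equiv.Perm (Fin n))) := by
  classical
  obtain ⟨y₀, hy₀⟩ := hY
  rintro ⟨x, z⟩ hxz ⟨x₁, z₁⟩ hxz₁ heq
  simp only [Finset.coe_product, Set.mem_prod, Finset.mem_coe] at hxz hxz₁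
  simp only at heq
  obtain ⟨c, hc⟩ := h x hxz.1 z hxz.2
  have h0 := hc x hxz.1 y₀ hy₀ y₀ hy₀ z hxz.2
  rw [if_pos ⟨rfl, rfl, rfl⟩] at h0
  have h1 := hc x₁ hxz₁.1 y₀ hy₀ y₀ hy₀ z₁ hxz₁.2
  have : x₁⁻¹ * y₀ * y₀⁻¹ * z₁ = x⁻¹ * y₀ * y₀⁻¹ * z := by
    have e1 : x₁⁻¹ * y₀ * y₀⁻¹ * z₁ = x₁⁻¹ * z₁ := by group
    have e2 : x⁻¹ * y₀ * y₀⁻¹ * z = x⁻¹ * z := by group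
    rw [e1, e2]; exact heq.symm
  rw [this, h0] at h1
  by_cases hcond : x₁ = x ∧ y₀ = y₀ ∧ z₁ = z
  · exact Prod.ext hcond.1.symm hcond.2.2.symm
  · rw [if_neg hcond] at h1; exact absurd h1 one_ne_zero

/-- **Half the packing bound.** For a `k`-token separated triple with `k + 2 ≤ n`:
`4 (|X||Y||Z|)² ≤ (n!)³`, i.e. `|X||Y||Z| ≤ (n!)^{3/2} / 2` (covering wall `ab + bc ≤ n!` and
`ac ≤ n!`; AM–GM).  The classical TPP packing bound is `(n!)^{3/2}`. -/
theorem four_mul_volume_sq_le {n k : ℕ} {X Y Z : Finset (Equiv.Perm (Fin n))}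
    (h : Sep n k X Y Z) (hk : k + 2 ≤ n) :
    4 * (X.card * Y.card * Z.card) ^ 2 ≤ n.factorial ^ 3 := by
  classical
  rcases X.eq_empty_or_nonempty with hX | hX
  · simp [hX]
  rcases Y.eq_empty_or_nonempty with hY | hY
  · simp [hY]
  rcases Z.eq_empty_or_nonempty with hZ | hZ
  · simp [hZ]
  have h1 := card_add_card_le_factorial h hk hX hZ
  have h2 : X.card * Z.card ≤ n.factorial := by
    have := Finset.card_le_univ ((X ×ˢ Z).image
      (fun q : Equiv.Perm (Fin n) × Equiv.Perm (Fin n) => q.1⁻¹ * q.2))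
    rwa [Finset.card_image_of_injOn (quotXZ_injOn h hY), Finset.card_product,
      Fintype.card_perm, Fintype.card_fin] at this
  set a := X.card; set b := Y.card; set c := Z.card
  -- 4(ab)(bc) ≤ (ab+bc)² ≤ (n!)², and ac ≤ n!
  have h3 : 4 * (a * b) * (b * c) ≤ n.factorial ^ 2 := by
    calc 4 * (a * b) * (b * c) ≤ (a * b + b * c) ^ 2 := by nlinarith [sq_nonneg (a*b - b*c : ℤ), sq_abs (a*b - b*c : ℤ)]
      _ ≤ n.factorial ^ 2 := Nat.pow_le_pow_left h1 2
  calc 4 * (a * b * c) ^ 2 = (4 * (a * b) * (b * c)) * (a * c) := by ring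
    _ ≤ n.factorial ^ 2 * n.factorial := Nat.mul_le_mul h3 h2
    _ = n.factorial ^ 3 := by ring

/-! ## Dimension walls: `|X||Y|, |Y||Z|, |X||Z| ≤ dim T_k`

`T_k` = the `k`-token test space as a submodule; the separators and their translates form
"dual bases", hence are linearly independent.  (Route item `TokenWall` = these plus the count
`dim T_k = ∑_{μ₁ ≥ n-k} (f^μ)²`, which is not proved here.) -/

/-- The `k`-token map `c ↦ (g ↦ ∑_p c p (g ∘ p))` as a linear map. -/
def tokenMap (n k : ℕ) : ((Fin k → Fin n) → (Fin k → Fin n) → ℂ) →ₗ[ℂ] (Equiv.Perm (Fin n) → ℂ) where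
  toFun c := tokenFn c
  map_add' c c' := by
    funext g; simp [tokenFn, Finset.sum_add_distrib]
  map_smul' r c := by
    funext g; simp [tokenFn, Finset.mul_sum]

/-- The `k`-token test space `T_k ≤ ℂ^{𝔖ₙ}` (= EFP's `V_k`, = `kCosetSpan n k`). -/
def tokenSpace (n k : ℕ) : Submodule ℂ (Equiv.Perm (Fin n) → ℂ) :=
  LinearMap.range (tokenMap n k)

theorem tokenFn_mem_tokenSpace {n k : ℕ} (c : (Fin k → Fin n) → (Fin k → Fin n) → ℂ) :
    tokenFn c ∈ tokenSpace n k :=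
  ⟨c, rfl⟩

theorem translate_mem_tokenSpace {n k : ℕ} {f : Equiv.Perm (Fin n) → ℂ} (hf : f ∈ tokenSpace n k)
    (a b : Equiv.Perm (Fin n)) : (fun g => f (a * g * b)) ∈ tokenSpace n k := by
  obtain ⟨c, rfl⟩ := hf
  exact ⟨fun p q => c (⇑b⁻¹ ∘ p) (⇑a ∘ q), funext fun g => (tokenFn_translate c a b g).symm⟩

instance (n k : ℕ) : Module.Finite ℂ (tokenSpace n k) := by
  unfold tokenSpace; infer_instance

/-- A family in `T_k` with a system of "dual points" is linearly independent. -/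
theorem linearIndependent_of_dualPoints {n k : ℕ} {ι : Type*} [Fintype ι]
    (v : ι → tokenSpace n k) (pt : ι → Equiv.Perm (Fin n))
    (hv₁ : ∀ i, (v i : Equiv.Perm (Fin n) → ℂ) (pt i) = 1)
    (hv₀ : ∀ i j, i ≠ j → (v j : Equiv.Perm (Fin n) → ℂ) (pt i) = 0) :
    LinearIndependent ℂ v := by
  rw [Fintype.linearIndependent_iff]
  intro g hg i
  have := congrArg (fun w : tokenSpace n k => (w : Equiv.Perm (Fin n) → ℂ) (pt i)) hg
  simp only [Submodule.coe_sum, Submodule.coe_smul, Finset.sum_apply, Pi.smul_apply, smul_eq_mul,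
    Submodule.coe_zero, Pi.zero_apply] at this
  rw [Finset.sum_eq_single i (fun j _ hji => by rw [hv₀ i j (Ne.symm hji), mul_zero])
    (fun hi => absurd (Finset.mem_univ i) hi), hv₁ i, mul_one] at this
  exact this

/-- Wall `|X|·|Z| ≤ dim T_k` (the separators themselves; `Y ≠ ∅`). -/
theorem card_X_mul_card_Z_le_finrank {n k : ℕ} {X Y Z : Finset (Equiv.Perm (Fin n))}
    (h : Sep n k X Y Z) (hY : Y.Nonempty) :
    X.card * Z.card ≤ Module.finrank ℂ (tokenSpace n k) := by
  classical
  obtain ⟨y₁, hy₁⟩ := hY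
  choose c hc using h
  let v : X × Z → tokenSpace n k := fun i =>
    ⟨tokenFn (c i.1 i.1.2 i.2 i.2.2), tokenFn_mem_tokenSpace _⟩
  have hli : LinearIndependent ℂ v := by
    refine linearIndependent_of_dualPoints v
      (fun i => (i.1 : Equiv.Perm (Fin n))⁻¹ * y₁ * y₁⁻¹ * i.2) ?_ ?_
    · rintro ⟨⟨x, hx⟩, ⟨z, hz⟩⟩
      change tokenFn (c x hx z hz) (x⁻¹ * y₁ * y₁⁻¹ * z) = _
      unfold tokenFn
      rw [hc x hx z hz x hx y₁ hy₁ y₁ hy₁ z hz, if_pos ⟨rfl, rfl, rfl⟩]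
    · rintro ⟨⟨x, hx⟩, ⟨z, hz⟩⟩ ⟨⟨x₀, hx₀⟩, ⟨z₀, hz₀⟩⟩ hne
      change tokenFn (c x₀ hx₀ z₀ hz₀) (x⁻¹ * y₁ * y₁⁻¹ * z) = _
      unfold tokenFn
      rw [hc x₀ hx₀ z₀ hz₀ x hx y₁ hy₁ y₁ hy₁ z hz, if_neg]
      rintro ⟨rfl, -, rfl⟩
      exact hne rfl
  have := hli.fintype_card_le_finrank
  rwa [Fintype.card_prod, Fintype.card_coe, Fintype.card_coe] at this

/-- Wall `|X|·|Y| ≤ dim T_k` (right translates of the separators of one column `z₁`). -/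
theorem card_X_mul_card_Y_le_finrank {n k : ℕ} {X Y Z : Finset (Equiv.Perm (Fin n))}
    (h : Sep n k X Y Z) (hZ : Z.Nonempty) :
    X.card * Y.card ≤ Module.finrank ℂ (tokenSpace n k) := by
  classical
  obtain ⟨z₁, hz₁⟩ := hZ
  choose c hc using h
  let v : X × Y → tokenSpace n k := fun i =>
    ⟨fun w => tokenFn (c i.1 i.1.2 z₁ hz₁) (1 * w * ((i.2 : Equiv.Perm (Fin n))⁻¹ * z₁)),
      translate_mem_tokenSpace (tokenFn_mem_tokenSpace _) 1 _⟩
  have hli : LinearIndependent ℂ v := by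
    refine linearIndependent_of_dualPoints v (fun i => (i.1 : Equiv.Perm (Fin n))⁻¹ * i.2) ?_ ?_
    · rintro ⟨⟨x, hx⟩, ⟨y, hy⟩⟩
      change tokenFn (c x hx z₁ hz₁) (1 * (x⁻¹ * y) * (y⁻¹ * z₁)) = _
      rw [show (1 * (x⁻¹ * y) * (y⁻¹ * z₁)) = x⁻¹ * y * y⁻¹ * z₁ by group]
      unfold tokenFn
      rw [hc x hx z₁ hz₁ x hx y hy y hy z₁ hz₁, if_pos ⟨rfl, rfl, rfl⟩]
    · rintro ⟨⟨x, hx⟩, ⟨y, hy⟩⟩ ⟨⟨x₀, hx₀⟩, ⟨y', hy'⟩⟩ hne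
      change tokenFn (c x₀ hx₀ z₁ hz₁) (1 * (x⁻¹ * y) * (y'⁻¹ * z₁)) = _
      rw [show (1 * (x⁻¹ * y) * (y'⁻¹ * z₁)) = x⁻¹ * y * y'⁻¹ * z₁ by group]
      unfold tokenFn
      rw [hc x₀ hx₀ z₁ hz₁ x hx y hy y' hy' z₁ hz₁, if_neg]
      rintro ⟨rfl, rfl, -⟩
      exact hne rfl
  have := hli.fintype_card_le_finrank
  rwa [Fintype.card_prod, Fintype.card_coe, Fintype.card_coe] at this

/-- Wall `|Y|·|Z| ≤ dim T_k` (left translates of the separators of one row `x₁`). -/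
theorem card_Y_mul_card_Z_le_finrank {n k : ℕ} {X Y Z : Finset (Equiv.Perm (Fin n))}
    (h : Sep n k X Y Z) (hX : X.Nonempty) :
    Y.card * Z.card ≤ Module.finrank ℂ (tokenSpace n k) := by
  classical
  obtain ⟨x₁, hx₁⟩ := hX
  choose c hc using h
  let v : Y × Z → tokenSpace n k := fun i =>
    ⟨fun w => tokenFn (c x₁ hx₁ i.2 i.2.2) ((x₁⁻¹ * (i.1 : Equiv.Perm (Fin n))) * w * 1),
      translate_mem_tokenSpace (tokenFn_mem_tokenSpace _) _ 1⟩
  have hli : LinearIndependent ℂ v := by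
    refine linearIndependent_of_dualPoints v (fun i => (i.1 : Equiv.Perm (Fin n))⁻¹ * i.2) ?_ ?_
    · rintro ⟨⟨y, hy⟩, ⟨z, hz⟩⟩
      change tokenFn (c x₁ hx₁ z hz) ((x₁⁻¹ * y) * (y⁻¹ * z) * 1) = _
      rw [show ((x₁⁻¹ * y) * (y⁻¹ * z) * 1) = x₁⁻¹ * y * y⁻¹ * z by group]
      unfold tokenFn
      rw [hc x₁ hx₁ z hz x₁ hx₁ y hy y hy z hz, if_pos ⟨rfl, rfl, rfl⟩]
    · rintro ⟨⟨y', hy'⟩, ⟨z, hz⟩⟩ ⟨⟨y, hy⟩, ⟨z₀, hz₀⟩⟩ hne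
      change tokenFn (c x₁ hx₁ z₀ hz₀) ((x₁⁻¹ * y) * (y'⁻¹ * z) * 1) = _
      rw [show ((x₁⁻¹ * y) * (y'⁻¹ * z) * 1) = x₁⁻¹ * y * y'⁻¹ * z by group]
      unfold tokenFn
      rw [hc x₁ hx₁ z₀ hz₀ x₁ hx₁ y hy y' hy' z hz, if_neg]
      rintro ⟨-, rfl, rfl⟩
      exact hne rfl
  have := hli.fintype_card_le_finrank
  rwa [Fintype.card_prod, Fintype.card_coe, Fintype.card_coe] at this

/-- The three walls combined: `(|X||Y||Z|)² ≤ (dim T_k)³`. -/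
theorem volume_sq_le_finrank_cube {n k : ℕ} {X Y Z : Finset (Equiv.Perm (Fin n))}
    (h : Sep n k X Y Z) :
    (X.card * Y.card * Z.card) ^ 2 ≤ Module.finrank ℂ (tokenSpace n k) ^ 3 := by
  classical
  rcases X.eq_empty_or_nonempty with hX | hX
  · simp [hX]
  rcases Y.eq_empty_or_nonempty with hY | hY
  · simp [hY]
  rcases Z.eq_empty_or_nonempty with hZ | hZ
  · simp [hZ]
  have h1 := card_X_mul_card_Y_le_finrank h hZ
  have h2 := card_Y_mul_card_Z_le_finrank h hX
  have h3 := card_X_mul_card_Z_le_finrank h hY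
  calc (X.card * Y.card * Z.card) ^ 2 = (X.card * Y.card) * (Y.card * Z.card) * (X.card * Z.card) := by
        ring
    _ ≤ Module.finrank ℂ (tokenSpace n k) * Module.finrank ℂ (tokenSpace n k) *
        Module.finrank ℂ (tokenSpace n k) := by gcongr
    _ = Module.finrank ℂ (tokenSpace n k) ^ 3 := by ring


/-! ## `f^{(n)} = 1`, the level-0 budget, and two load-bearing clauses of the rendering

* `budget_zero : budget n 0 ε = 1` — at level 0 only the trivial partition pays.
* `exists_budget_lt_volPow` — WITHOUT the separation clause the inequality is trivially
  satisfiable (`n = 2, k = 0, X = 𝔖₂, Y = Z = {1}`): separation is load-bearing.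
* `at_le_version_trivial` — with `≤` in place of `<` the crux is trivially TRUE (singletons at
  level 0: budget `1 ≤ 1` = volume): the strict inequality is load-bearing against this junk. -/

theorem sup_lt_of_ne_indiscrete {n : ℕ} {μ : Nat.Partition n} (hμ : μ ≠ Nat.Partition.indiscrete n) :
    μ.parts.sup < n := by
  rcases Nat.eq_zero_or_pos n with rfl | hn
  · exact absurd (Subsingleton.elim μ _) hμ
  suffices hall : ∀ a ∈ μ.parts, a ≤ n - 1 by
    have := Multiset.sup_le.mpr hall
    omega
  intro a ha
  by_contra hle
  push Not at hle
  apply hμ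
  obtain ⟨rest, hrest⟩ := Multiset.exists_cons_of_mem ha
  have hsum := μ.parts_sum
  rw [hrest, Multiset.sum_cons] at hsum
  have ha_eq : a = n := by
    have : a ≤ a + rest.sum := Nat.le_add_right _ _
    omega
  have hrest0 : rest = 0 := by
    rw [Multiset.eq_zero_iff_forall_notMem]
    intro b hb
    have hbpos : 0 < b := μ.parts_pos (by rw [hrest]; exact Multiset.mem_cons_of_mem hb)
    have : b ≤ rest.sum := Multiset.le_sum_of_mem hb
    omega
  ext1
  rw [hrest, hrest0, ha_eq, Nat.Partition.indiscrete_parts hn.ne']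
  rfl

theorem numStandardTableaux_indiscrete (n : ℕ) :
    numStandardTableaux (Nat.Partition.indiscrete n) = 1 := by
  classical
  set μ := Nat.Partition.indiscrete n with hμ
  rw [Literature.NumberTheory.DiophantineGeometry.numStandardTableaux_eq_card_stdFilling]
  -- sorted parts and the diagram: one row of length n
  have hsp : μ.sortedParts = if n = 0 then [] else [n] := by
    rcases Nat.eq_zero_or_pos n with rfl | hn
    · simp [Nat.Partition.sortedParts]
    · rw [if_neg hn.ne', Nat.Partition.sortedParts, Nat.Partition.indiscrete_parts hn.ne']
      simp
  have hmem : ∀ c : ℕ × ℕ, c ∈ μ.youngDiagram ↔ c.1 < 1 ∧ c.2 < n := by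
    intro c
    rw [Nat.Partition.mem_youngDiagram_iff, hsp]
    rcases Nat.eq_zero_or_pos n with rfl | hn
    · simp
    · simp only [if_neg hn.ne', List.length_singleton]
      constructor
      · rintro ⟨h1, h2⟩
        have : c.1 = 0 := by omega
        simp only [this, List.getElem_cons_zero] at h2
        exact ⟨h1, h2⟩
      · rintro ⟨h1, h2⟩
        refine ⟨h1, ?_⟩
        have : c.1 = 0 := by omega
        simp only [this, List.getElem_cons_zero]
        exact h2
  have hN : ∀ c ∈ μ.youngDiagram.cells, c.1 < 1 := fun c hc =>
    ((hmem c).1 ((YoungDiagram.mem_cells _).1 hc)).1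
  have hrow : μ.youngDiagram.rowLen 0 = n :=
    YoungDiagram.rowLen_eq_of_forall_mem_iff (fun j => by rw [hmem]; simp)
  have key := Literature.NumberTheory.DiophantineGeometry.card_stdFilling_mul_prod_factorial
    1 n μ.youngDiagram μ.card_cells_youngDiagram hN
  simp only [Finset.range_one, Finset.prod_singleton, hrow, Nat.sub_self, add_zero] at key
  have hIoo : Finset.Ioo 0 1 = ∅ := by decide
  rw [hIoo, Finset.prod_empty, mul_one] at key
  have hfac : (n.factorial : ℚ) ≠ 0 := by exact_mod_cast n.factorial_ne_zero
  have : (Nat.card (Literature.NumberTheory.DiophantineGeometry.StdFilling n μ.youngDiagram) : ℚ) = 1 := by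
    field_simp at key
    linarith [key]
  exact_mod_cast this

theorem budget_zero (n : ℕ) (ε : ℝ) : budget n 0 ε = 1 := by
  classical
  unfold budget
  rw [Finset.sum_eq_single (Nat.Partition.indiscrete n)]
  · rw [if_pos (indiscrete_sup_ge n 0), numStandardTableaux_indiscrete]
    simp
  · intro μ _ hμ
    rw [if_neg]
    have := sup_lt_of_ne_indiscrete hμ
    omega
  · intro h; exact absurd (Finset.mem_univ _) h

/-- LOAD-BEARING (separation): with the separation clause dropped, the inequality
`budget < volume^{(2+ε)/3}` is trivially satisfiable for every `ε > 0`. -/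
theorem exists_budget_lt_volPow {ε : ℝ} (hε : 0 < ε) :
    ∃ (n k : ℕ) (X Y Z : Finset (Equiv.Perm (Fin n))), budget n k ε < volPow ε X Y Z := by
  classical
  refine ⟨2, 0, Finset.univ, {1}, {1}, ?_⟩
  rw [budget_zero]
  unfold volPow
  rw [Finset.card_univ, Fintype.card_perm, Fintype.card_fin, Finset.card_singleton]
  norm_num
  exact Real.one_lt_rpow (by norm_num) (by positivity)

/-- Singletons are `0`-token separated (the constant test functional `1`). -/
theorem sep_zero_singleton {n : ℕ} (x y z : Equiv.Perm (Fin n)) : Sep n 0 {x} {y} {z} := by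
  intro x₀ hx₀ z₀ hz₀
  refine ⟨fun _ _ => 1, ?_⟩
  intro x' hx' y' hy' y'' hy'' z' hz'
  simp only [Finset.mem_singleton] at hx₀ hz₀ hx' hy' hy'' hz'
  subst hx₀; subst hz₀; subst hx'; subst hy'; subst hy''; subst hz'
  simp

/-- LOAD-BEARING (strictness): the `≤`-version of the crux inequality is met with EQUALITY by
singletons at level 0 (`budget = 1 = volume`), for every `ε`; the strict `<` excludes exactly
this junk (cf. `not_at_level_zero`). -/
theorem at_le_version_trivial (ε : ℝ) (n : ℕ) :
    ∃ (k : ℕ) (X Y Z : Finset (Equiv.Perm (Fin n))),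
      Sep n k X Y Z ∧ budget n k ε = volPow ε X Y Z := by
  refine ⟨0, {1}, {1}, {1}, sep_zero_singleton 1 1 1, ?_⟩
  rw [budget_zero]
  unfold volPow
  simp


/-! ## Level `k = 1` is dead (the window `(c₁(3), c₁(2)] = (1, 1]` is empty)

Ingredients: `f^{(n-1,1)} = n - 1` (Frobenius formula with two rows), so
`budget n 1 ε ≥ 1 + (n-1)^{2+ε}`; `dim T_1 ≤ (n-1)² + 1` (the permutation-matrix entries
`[g i = j]`, `i, j < n-1`, and the constant `1` span `T_1`); the three walls and INTEGRALITY: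
pairwise products `≤ (n-1)²+1` force `|X||Y||Z| ≤ (n-1)³` for `n ≥ 3`; hence
`volume^{(2+ε)/3} ≤ (n-1)^{2+ε} < budget`.  For `n = 2` the same holds iff `ε ≤ 1`
(`n = 2, k = 1, X = 𝔖₂, Y = Z = {1}` works for `ε > 1`). -/

/-- The partition `(n-1, 1)` of `n ≥ 2`. -/
def twoRow (n : ℕ) (hn : 2 ≤ n) : Nat.Partition n where
  parts := {n - 1, 1}
  parts_pos h := by
    simp only [Multiset.insert_eq_cons, Multiset.mem_cons, Multiset.mem_singleton] at h
    omega
  parts_sum := by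
    simp only [Multiset.insert_eq_cons, Multiset.sum_cons, Multiset.sum_singleton]
    omega

theorem twoRow_parts (n : ℕ) (hn : 2 ≤ n) : (twoRow n hn).parts = ({n - 1, 1} : Multiset ℕ) := rfl

theorem twoRow_sup (n : ℕ) (hn : 2 ≤ n) : (twoRow n hn).parts.sup = n - 1 := by
  rw [twoRow_parts]
  simp only [Multiset.insert_eq_cons, Multiset.sup_cons, Multiset.sup_singleton]
  exact max_eq_left (by omega)

theorem twoRow_ne_indiscrete (n : ℕ) (hn : 2 ≤ n) : twoRow n hn ≠ Nat.Partition.indiscrete n :=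
  Literature.RepresentationTheory.FiniteGroups.ne_indiscrete_of_parts_eq (twoRow_parts n hn)

/-- `f^{(n-1,1)} = n - 1` (Frobenius–Young degree formula of the tree with `N = 2` rows:
`f · n! · 1! = n! · (n - 1)`). -/
theorem numStandardTableaux_twoRow (n : ℕ) (hn : 2 ≤ n) :
    numStandardTableaux (twoRow n hn) = n - 1 := by
  classical
  set μ := twoRow n hn with hμ
  have hsp : μ.sortedParts = [n - 1, 1] :=
    Literature.RepresentationTheory.FiniteGroups.sortedParts_twoRow (twoRow_parts n hn)
  rw [Literature.NumberTheory.DiophantineGeometry.numStandardTableaux_eq_card_stdFilling]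
  have hN : ∀ c ∈ μ.youngDiagram.cells, c.1 < 2 := fun c hc =>
    Literature.NumberTheory.DiophantineGeometry.fst_lt_of_mem_youngDiagram μ
      (by rw [twoRow_parts]; simp) hc
  have hrow0 : μ.youngDiagram.rowLen 0 = n - 1 := by
    rw [Literature.NumberTheory.DiophantineGeometry.rowLen_youngDiagram, hsp]; rfl
  have hrow1 : μ.youngDiagram.rowLen 1 = 1 := by
    rw [Literature.NumberTheory.DiophantineGeometry.rowLen_youngDiagram, hsp]; rfl
  have key := Literature.NumberTheory.DiophantineGeometry.card_stdFilling_mul_prod_factorial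
    2 n μ.youngDiagram μ.card_cells_youngDiagram hN
  have hI0 : Finset.Ioo 0 2 = {1} := by decide
  have hI1 : Finset.Ioo 1 2 = ∅ := by decide
  simp only [Finset.prod_range_succ, Finset.range_one, Finset.prod_singleton, hrow0, hrow1, hI0, hI1,
    Finset.prod_empty, mul_one, Nat.sub_self, add_zero] at key
  -- key : card * (n - 1 + 1)! = n! * (↑(n - 1 + 1) - 1)  (in ℚ)
  have h1 : n - 1 + (2 - 1 - 0) = n := by omega
  rw [h1] at key
  try simp only [Nat.factorial_one, Nat.cast_one, mul_one] at key
  have hfac : (n.factorial : ℚ) ≠ 0 := by exact_mod_cast n.factorial_ne_zero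
  have hcast : ((n - 1 : ℕ) : ℚ) = (n : ℚ) - 1 := by
    rw [Nat.cast_sub (by omega), Nat.cast_one]
  have : (Nat.card (Literature.NumberTheory.DiophantineGeometry.StdFilling n μ.youngDiagram) : ℚ)
      = ((n - 1 : ℕ) : ℚ) := by
    rw [hcast]
    exact mul_right_cancel₀ hfac (key.trans (mul_comm _ _))
  exact_mod_cast this

/-- At level 1 the budget is at least `1 + (n-1)^{2+ε}` (`n ≥ 2`, `2 + ε ≥ 0`). -/
theorem budget_one_ge {n : ℕ} (hn : 2 ≤ n) (ε : ℝ) :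
    1 + ((n - 1 : ℕ) : ℝ) ^ (2 + ε) ≤ budget n 1 ε := by
  classical
  unfold budget
  have hterm : ∀ μ : Nat.Partition n, 0 ≤ (if n - 1 ≤ μ.parts.sup then
      (numStandardTableaux μ : ℝ) ^ (2 + ε) else 0) := by
    intro μ; split_ifs
    · positivity
    · exact le_rfl
  have hsub : ({Nat.Partition.indiscrete n, twoRow n hn} : Finset (Nat.Partition n)) ⊆ Finset.univ :=
    Finset.subset_univ _
  refine le_trans ?_ (Finset.sum_le_sum_of_subset_of_nonneg hsub (fun μ _ _ => hterm μ))
  rw [Finset.sum_pair (twoRow_ne_indiscrete n hn).symm, if_pos (indiscrete_sup_ge n 1),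
    numStandardTableaux_indiscrete, if_pos (by rw [twoRow_sup]), numStandardTableaux_twoRow]
  simp

/-! ### `dim T_1 ≤ (n-1)² + 1` -/

/-- The permutation-matrix entry `[g i = j]` as a function on `𝔖ₙ`. -/
def entryFn {n : ℕ} (i j : Fin n) (g : Equiv.Perm (Fin n)) : ℂ := if g i = j then 1 else 0

theorem sum_entryFn_right {n : ℕ} (i : Fin n) : ∑ j, entryFn i j = (1 : Equiv.Perm (Fin n) → ℂ) := by
  funext g
  simp [entryFn, Finset.sum_apply]

theorem sum_entryFn_left {n : ℕ} (j : Fin n) : ∑ i, entryFn i j = (1 : Equiv.Perm (Fin n) → ℂ) := by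
  funext g
  simp only [Finset.sum_apply, entryFn, Pi.one_apply]
  simp_rw [Equiv.apply_eq_iff_eq_symm_apply g]
  simp

/-- The spanning family: entries `[g i = j]` with `i, j < m` and the constant `1` (`n = m + 1`). -/
def smallFamily (m : ℕ) : Option (Fin m × Fin m) → (Equiv.Perm (Fin (m + 1)) → ℂ)
  | none => 1
  | some ij => entryFn (Fin.castSucc ij.1) (Fin.castSucc ij.2)

theorem entryFn_mem_span (m : ℕ) (i j : Fin (m + 1)) :
    entryFn i j ∈ Submodule.span ℂ (Set.range (smallFamily m)) := by
  set S := Submodule.span ℂ (Set.range (smallFamily m)) with hS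
  have hone : (1 : Equiv.Perm (Fin (m + 1)) → ℂ) ∈ S := Submodule.subset_span ⟨none, rfl⟩
  have hsmall : ∀ i' j' : Fin m, entryFn (Fin.castSucc i') (Fin.castSucc j') ∈ S :=
    fun i' j' => Submodule.subset_span ⟨some (i', j'), rfl⟩
  -- rows with `i < m`: the last column entry from the row relation
  have hrow : ∀ i' : Fin m, ∀ j : Fin (m + 1), entryFn (Fin.castSucc i') j ∈ S := by
    intro i' j
    induction j using Fin.lastCases with
    | cast j' => exact hsmall i' j'
    | last =>
      have h := sum_entryFn_right (n := m + 1) (Fin.castSucc i')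
      rw [Fin.sum_univ_castSucc] at h
      have : entryFn (Fin.castSucc i') (Fin.last m) =
          1 - ∑ j' : Fin m, entryFn (Fin.castSucc i') (Fin.castSucc j') := by
        rw [← h]; abel
      rw [this]
      exact S.sub_mem hone (S.sum_mem fun j' _ => hsmall i' j')
  induction i using Fin.lastCases with
  | cast i' => exact hrow i' j
  | last =>
    have h := sum_entryFn_left (n := m + 1) j
    rw [Fin.sum_univ_castSucc] at h
    have : entryFn (Fin.last m) j = 1 - ∑ i' : Fin m, entryFn (Fin.castSucc i') j := by
      rw [← h]; abel
    rw [this]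
    exact S.sub_mem hone (S.sum_mem fun i' _ => hrow i' j)

theorem tokenSpace_one_le_span (m : ℕ) :
    tokenSpace (m + 1) 1 ≤ Submodule.span ℂ (Set.range (smallFamily m)) := by
  rintro f ⟨c, rfl⟩
  -- `tokenFn c = ∑_{i j} c (const i) (const j) • entryFn i j`
  have hf : (tokenMap (m + 1) 1 c : Equiv.Perm (Fin (m + 1)) → ℂ) =
      ∑ i : Fin (m + 1), ∑ j : Fin (m + 1), c (fun _ => i) (fun _ => j) • entryFn i j := by
    funext g
    change tokenFn c g = _
    unfold tokenFn
    simp only [Finset.sum_apply, Pi.smul_apply, smul_eq_mul, entryFn, mul_ite, mul_one, mul_zero,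
      Finset.sum_ite_eq, Finset.mem_univ, if_true]
    rw [← (Equiv.funUnique (Fin 1) (Fin (m + 1))).symm.sum_comp]
    refine Finset.sum_congr rfl fun i _ => ?_
    congr 1
  rw [hf]
  refine Submodule.sum_mem _ fun i _ => Submodule.sum_mem _ fun j _ => ?_
  exact Submodule.smul_mem _ _ (entryFn_mem_span m i j)

/-- `dim T_1 ≤ (n-1)² + 1`. -/
theorem finrank_tokenSpace_one_le (n : ℕ) (hn : 1 ≤ n) :
    Module.finrank ℂ (tokenSpace n 1) ≤ (n - 1) ^ 2 + 1 := by
  obtain ⟨m, rfl⟩ : ∃ m, n = m + 1 := ⟨n - 1, by omega⟩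
  simp only [Nat.add_sub_cancel]
  calc Module.finrank ℂ (tokenSpace (m + 1) 1)
      ≤ Module.finrank ℂ (Submodule.span ℂ (Set.range (smallFamily m))) :=
        Submodule.finrank_mono (tokenSpace_one_le_span m)
    _ ≤ Fintype.card (Option (Fin m × Fin m)) := finrank_range_le_card _
    _ = m ^ 2 + 1 := by simp [Fintype.card_option, Fintype.card_prod, Fintype.card_fin, sq]

/-! ### Integrality and the level-1 verdict -/

/-- Pairwise products `≤ N² + 1` with `N ≥ 2` force the triple product `≤ N³`. -/
theorem mul_mul_le_cube_of_pairwise {a b c N : ℕ} (hN : 2 ≤ N) (hab : a * b ≤ N ^ 2 + 1)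
    (hbc : b * c ≤ N ^ 2 + 1) (hac : a * c ≤ N ^ 2 + 1) : a * b * c ≤ N ^ 3 := by
  have small : ∀ {u v : ℕ}, u * v ≤ N ^ 2 + 1 → N + 1 ≤ u → v ≤ N - 1 := by
    intro u v huv hu
    have h1 : v * (N + 1) ≤ N ^ 2 + 1 := le_trans (by nlinarith) huv
    have h2 : N ^ 2 + 1 < N * (N + 1) := by nlinarith
    have h3 : v < N := Nat.lt_of_mul_lt_mul_right (lt_of_le_of_lt h1 h2)
    omega
  have big : (N ^ 2 + 1) * (N - 1) ≤ N ^ 3 := by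
    obtain ⟨M, rfl⟩ : ∃ M, N = M + 1 := ⟨N - 1, by omega⟩
    simp only [Nat.add_sub_cancel]
    nlinarith
  by_cases ha : a ≤ N
  · by_cases hb : b ≤ N
    · by_cases hc : c ≤ N
      · calc a * b * c ≤ N * N * N := by gcongr
          _ = N ^ 3 := by ring
      · push Not at hc
        have hb' := small (by rwa [mul_comm] at hbc) hc
        have ha' := small (by rwa [mul_comm] at hac) hc
        calc a * b * c = (b * c) * a := by ring
          _ ≤ (N ^ 2 + 1) * (N - 1) := Nat.mul_le_mul hbc ha'
          _ ≤ N ^ 3 := big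
    · push Not at hb
      have hc' := small hbc hb
      have ha' := small (by rwa [mul_comm] at hab) hb
      calc a * b * c = (a * b) * c := by ring
        _ ≤ (N ^ 2 + 1) * (N - 1) := Nat.mul_le_mul hab hc'
        _ ≤ N ^ 3 := big
  · push Not at ha
    have hb' := small hab ha
    have hc' := small hac ha
    calc a * b * c = (a * c) * b := by ring
      _ ≤ (N ^ 2 + 1) * (N - 1) := Nat.mul_le_mul hac hb'
      _ ≤ N ^ 3 := big

/-- For a `1`-token separated triple in `𝔖ₙ`, `n ≥ 3`: `|X||Y||Z| ≤ (n-1)³`. -/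
theorem volume_le_cube_of_sep_one {n : ℕ} (hn : 3 ≤ n) {X Y Z : Finset (Equiv.Perm (Fin n))}
    (h : Sep n 1 X Y Z) : X.card * Y.card * Z.card ≤ (n - 1) ^ 3 := by
  classical
  rcases X.eq_empty_or_nonempty with hX | hX
  · simp [hX]
  rcases Y.eq_empty_or_nonempty with hY | hY
  · simp [hY]
  rcases Z.eq_empty_or_nonempty with hZ | hZ
  · simp [hZ]
  have hD := finrank_tokenSpace_one_le n (by omega)
  exact mul_mul_le_cube_of_pairwise (N := n - 1) (by omega)
    ((card_X_mul_card_Y_le_finrank h hZ).trans hD)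
    ((card_Y_mul_card_Z_le_finrank h hX).trans hD)
    ((card_X_mul_card_Z_le_finrank h hY).trans hD)

/-- **LEVEL 1 IS DEAD for `n ≥ 3` and every `ε > 0`.** -/
theorem not_at_level_one_of_three_le {ε : ℝ} (hε : 0 < ε) {n : ℕ} (hn : 3 ≤ n)
    (X Y Z : Finset (Equiv.Perm (Fin n))) : ¬ At ε n 1 X Y Z := by
  rintro ⟨hsep, hlt⟩
  have hV := volume_le_cube_of_sep_one hn hsep
  have hB := budget_one_ge (n := n) (by omega) ε
  set N : ℕ := n - 1 with hNdef
  have hNpos : (0 : ℝ) ≤ (N : ℝ) := by positivity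
  have hvol : volPow ε X Y Z ≤ (N : ℝ) ^ (2 + ε) := by
    unfold volPow
    have hcast : ((X.card * Y.card * Z.card : ℕ) : ℝ) ≤ ((N : ℝ) ^ (3 : ℕ)) := by
      exact_mod_cast hV
    calc ((X.card * Y.card * Z.card : ℕ) : ℝ) ^ ((2 + ε) / 3)
        ≤ ((N : ℝ) ^ (3 : ℕ)) ^ ((2 + ε) / 3) :=
          Real.rpow_le_rpow (by positivity) hcast (by positivity)
      _ = (N : ℝ) ^ (2 + ε) := by
          rw [← Real.rpow_natCast, ← Real.rpow_mul hNpos]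
          congr 1; push_cast; ring
  linarith

/-- Level 1 at `n = 2`: pairwise products `≤ 2` force volume `≤ 2`. -/
theorem volume_le_two_of_sep_one_two {X Y Z : Finset (Equiv.Perm (Fin 2))} (h : Sep 2 1 X Y Z) :
    X.card * Y.card * Z.card ≤ 2 := by
  classical
  rcases X.eq_empty_or_nonempty with hX | hX
  · simp [hX]
  rcases Y.eq_empty_or_nonempty with hY | hY
  · simp [hY]
  rcases Z.eq_empty_or_nonempty with hZ | hZ
  · simp [hZ]
  have hD : Module.finrank ℂ (tokenSpace 2 1) ≤ 2 := by
    have := finrank_tokenSpace_one_le 2 (by norm_num); simpa using this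
  have h1 := (card_X_mul_card_Y_le_finrank h hZ).trans hD
  have h2 := (card_Y_mul_card_Z_le_finrank h hX).trans hD
  have h3 := (card_X_mul_card_Z_le_finrank h hY).trans hD
  have ha := hX.card_pos; have hb := hY.card_pos; have hc := hZ.card_pos
  set a := X.card; set b := Y.card; set c := Z.card
  -- a*b ≤ 2, b*c ≤ 2, a*c ≤ 2, all ≥ 1 ⇒ abc ≤ 2
  rcases Nat.lt_or_ge 1 a with ha2 | ha1
  · have hb1 : b ≤ 1 := by nlinarith
    have hc1 : c ≤ 1 := by nlinarith
    calc a * b * c ≤ a * b * 1 := by gcongr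
      _ ≤ 2 := by simpa using h1
  · calc a * b * c ≤ 1 * b * c := by gcongr
      _ = b * c := by ring
      _ ≤ 2 := h2

/-- **LEVEL 1 IS DEAD at `n = 2` for `ε ≤ 1`** (and alive for `ε > 1`: `X = 𝔖₂, Y = Z = {1}`). -/
theorem not_at_level_one_two {ε : ℝ} (hε : 0 < ε) (hε1 : ε ≤ 1)
    (X Y Z : Finset (Equiv.Perm (Fin 2))) : ¬ At ε 2 1 X Y Z := by
  rintro ⟨hsep, hlt⟩
  have hV := volume_le_two_of_sep_one_two hsep
  have hB := budget_one_ge (n := 2) le_rfl ε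
  norm_num at hB
  have hvol : volPow ε X Y Z ≤ 2 := by
    unfold volPow
    calc ((X.card * Y.card * Z.card : ℕ) : ℝ) ^ ((2 + ε) / 3)
        ≤ (2 : ℝ) ^ ((2 + ε) / 3) := Real.rpow_le_rpow (by positivity) (by exact_mod_cast hV) (by positivity)
      _ ≤ (2 : ℝ) ^ (1 : ℝ) := Real.rpow_le_rpow_of_exponent_le (by norm_num) (by linarith)
      _ = 2 := Real.rpow_one 2
  linarith

/-- **LEVEL 1 IS DEAD for every `n` whenever `0 < ε ≤ 1`**: any proof of the crux must use
`k ≥ 2` for all small `ε` (the relevant regime). -/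
theorem not_at_level_one {ε : ℝ} (hε : 0 < ε) (hε1 : ε ≤ 1) (n : ℕ)
    (X Y Z : Finset (Equiv.Perm (Fin n))) : ¬ At ε n 1 X Y Z := by
  rcases Nat.lt_or_ge n 2 with hn | hn
  · exact not_at_of_le_one hε (by omega) 1 X Y Z
  rcases Nat.lt_or_ge n 3 with hn3 | hn3
  · obtain rfl : n = 2 := by omega
    exact not_at_level_one_two hε hε1 X Y Z
  · exact not_at_level_one_of_three_le hε hn3 X Y Z


/-! ## The `(ℤ/2)^{k+1}`-coset obstruction (sharpest local certificate)

For `K = ⟨k+1 pairwise disjoint transpositions⟩` every `k`-token functional `f` satisfies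
`∑_{κ ∈ K} sgn(g₀κ) f(g₀κ) = 0` for every `g₀` (each index map `p : [k] → [n]` misses one of the
`k+1` transposition supports — pigeonhole — and right multiplication by that transposition
preserves the fibre `{g ∘ p = q}` and the coset, flipping the sign).  Hence a `k`-token separated
triple has, for every target `(x₀, z₀)` and every such `K`, some `κ ∈ K` with `x₀⁻¹ z₀ κ ∉ Q`:
NO COSET `gK ⊆ Q = X⁻¹YY⁻¹Z` THROUGH A POINT OF `X⁻¹Z`.  In particular (taking `y = y'`,
resp. `x = x₀`): `X` and `Z` contain no left coset of a conjugate of `K`, and `YY⁻¹ ⊉ K'` for every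
conjugate `K'` (dense or "generic" sets fail this; rigid sets such as sharply `t`-transitive-like
families pass it). -/

/-- Pigeonhole: `k + 1` pairwise disjoint pairs cannot all meet a set of size `≤ k`. -/
theorem exists_pair_disjoint_range {n k : ℕ} (a b : Fin (k + 1) → Fin n)
    (ha : Function.Injective a) (hb : Function.Injective b) (hab : ∀ i j, a i ≠ b j)
    (p : Fin k → Fin n) : ∃ i, (∀ t, p t ≠ a i) ∧ (∀ t, p t ≠ b i) := by
  classical
  by_contra hno
  push Not at hno
  set R := Finset.univ.image p with hR
  have hRcard : R.card ≤ k := by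
    calc R.card ≤ (Finset.univ : Finset (Fin k)).card := Finset.card_image_le
      _ = k := by simp
  -- every `i` has a witness point of its pair inside `R`
  let w : Fin (k + 1) → Fin n := fun i => if a i ∈ R then a i else b i
  have hw : ∀ i, w i ∈ R := by
    intro i
    by_cases hai : a i ∈ R
    · simp [w, hai]
    · simp only [w, if_neg hai]
      obtain h1 | h1 := Classical.em (∀ t, p t ≠ a i)
      · obtain ⟨t, ht⟩ := hno i h1
        exact Finset.mem_image.mpr ⟨t, Finset.mem_univ _, ht⟩
      · push Not at h1
        obtain ⟨t, ht⟩ := h1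
        exact absurd (Finset.mem_image.mpr ⟨t, Finset.mem_univ _, ht⟩) hai
  have hlt : R.card < (Finset.univ : Finset (Fin (k + 1))).card := by simp; omega
  obtain ⟨i, -, j, -, hij, hwij⟩ := Finset.exists_ne_map_eq_of_card_lt_of_maps_to hlt
    (fun i _ => hw i)
  -- the pairs are disjoint
  apply hij
  simp only [w] at hwij
  split_ifs at hwij with h1 h2 h2
  · exact ha hwij
  · exact absurd hwij (hab i j)
  · exact absurd hwij.symm (hab j i)
  · exact hb hwij

open scoped Classical in
/-- The signed sum of a `k`-token functional over any coset `g₀ K`,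
`K = ⟨swap (a i) (b i) : i ≤ k⟩` with disjoint supports, vanishes. -/
theorem sum_coset_sign_mul_tokenFn {n k : ℕ} (a b : Fin (k + 1) → Fin n)
    (ha : Function.Injective a) (hb : Function.Injective b) (hab : ∀ i j, a i ≠ b j)
    (c : (Fin k → Fin n) → (Fin k → Fin n) → ℂ) (g₀ : Equiv.Perm (Fin n)) :
    ∑ κ : Subgroup.closure (Set.range fun i => Equiv.swap (a i) (b i)),
      ((Equiv.Perm.sign (g₀ * (κ : Equiv.Perm (Fin n))) : ℤ) : ℂ) *
        tokenFn c (g₀ * (κ : Equiv.Perm (Fin n))) = 0 := by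
  set K := Subgroup.closure (Set.range fun i => Equiv.swap (a i) (b i)) with hK
  unfold tokenFn
  simp_rw [Finset.mul_sum]
  rw [Finset.sum_comm]
  refine Finset.sum_eq_zero fun p _ => ?_
  obtain ⟨i, hpa, hpb⟩ := exists_pair_disjoint_range a b ha hb hab p
  have hτK : Equiv.swap (a i) (b i) ∈ K := Subgroup.subset_closure ⟨i, rfl⟩
  set τ : K := ⟨Equiv.swap (a i) (b i), hτK⟩ with hτ
  have haibi : a i ≠ b i := hab i i
  set F : K → ℂ := fun κ => ((Equiv.Perm.sign (g₀ * (κ : Equiv.Perm (Fin n))) : ℤ) : ℂ) *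
    c p (⇑(g₀ * (κ : Equiv.Perm (Fin n))) ∘ p) with hF
  have hreindex : ∑ κ, F κ = ∑ κ, F (κ * τ) :=
    (Fintype.sum_equiv (Equiv.mulRight τ) (fun κ => F (κ * τ)) F (fun κ => rfl)).symm
  have hflip : ∀ κ : K, F (κ * τ) = - F κ := by
    intro κ
    have hcoe : ((κ * τ : K) : Equiv.Perm (Fin n)) = (κ : Equiv.Perm (Fin n)) * Equiv.swap (a i) (b i) := rfl
    have hcomp : (⇑(g₀ * ((κ : Equiv.Perm (Fin n)) * Equiv.swap (a i) (b i))) ∘ p : Fin k → Fin n)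
        = ⇑(g₀ * (κ : Equiv.Perm (Fin n))) ∘ p := by
      funext t
      simp [Equiv.swap_apply_of_ne_of_ne (hpa t) (hpb t)]
    have hsign : ((Equiv.Perm.sign (g₀ * ((κ : Equiv.Perm (Fin n)) * Equiv.swap (a i) (b i))) : ℤ) : ℂ)
        = - ((Equiv.Perm.sign (g₀ * (κ : Equiv.Perm (Fin n))) : ℤ) : ℂ) := by
      rw [← mul_assoc, Equiv.Perm.sign_mul, Equiv.Perm.sign_swap haibi]
      push_cast; ring
    simp only [hF, hcoe]
    rw [hcomp, hsign, neg_mul]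
  have hS : ∑ κ, F κ = - ∑ κ, F κ := by
    conv_lhs => rw [hreindex]
    rw [← Finset.sum_neg_distrib]
    exact Finset.sum_congr rfl fun κ _ => hflip κ
  have h0 : ∑ κ, F κ = 0 := by
    have h2 : (2 : ℂ) * ∑ κ, F κ = 0 := by rw [two_mul]; nth_rewrite 1 [hS]; ring
    exact (mul_eq_zero.mp h2).resolve_left two_ne_zero
  simpa [hF] using h0

/-- **Coset obstruction.** A `k`-token separated triple has, through every target point
`x₀⁻¹z₀` and for every `K = ⟨k+1 disjoint transpositions⟩`, a point `x₀⁻¹ z₀ κ`, `κ ∈ K`, outside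
the quotient set `X⁻¹ Y Y⁻¹ Z`. -/
theorem exists_coset_point_not_mem_quot {n k : ℕ} {X Y Z : Finset (Equiv.Perm (Fin n))}
    (h : Sep n k X Y Z) (a b : Fin (k + 1) → Fin n)
    (ha : Function.Injective a) (hb : Function.Injective b) (hab : ∀ i j, a i ≠ b j)
    {x₀ : Equiv.Perm (Fin n)} (hx₀ : x₀ ∈ X) {z₀ : Equiv.Perm (Fin n)} (hz₀ : z₀ ∈ Z) :
    ∃ κ ∈ Subgroup.closure (Set.range fun i => Equiv.swap (a i) (b i)),
      ∀ x ∈ X, ∀ y ∈ Y, ∀ y' ∈ Y, ∀ z ∈ Z, x⁻¹ * y * y'⁻¹ * z ≠ x₀⁻¹ * z₀ * κ := by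
  classical
  set K := Subgroup.closure (Set.range fun i => Equiv.swap (a i) (b i)) with hK
  by_contra hall
  push Not at hall
  obtain ⟨c, hc⟩ := h x₀ hx₀ z₀ hz₀
  -- on the coset the separator is the indicator of `κ = 1`
  have hf : ∀ κ : K, tokenFn c (x₀⁻¹ * z₀ * (κ : Equiv.Perm (Fin n))) = if κ = 1 then 1 else 0 := by
    intro κ
    obtain ⟨x, hx, y, hy, y', hy', z, hz, hg⟩ := hall κ κ.2
    have hval := hc x hx y hy y' hy' z hz
    change tokenFn c (x⁻¹ * y * y'⁻¹ * z) = _ at hval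
    rw [hg] at hval
    rw [hval]
    by_cases hcond : x = x₀ ∧ y = y' ∧ z = z₀
    · obtain ⟨rfl, rfl, rfl⟩ := hcond
      have hκ : (κ : Equiv.Perm (Fin n)) = 1 := by
        have : x⁻¹ * y * y⁻¹ * z = x⁻¹ * z := by group
        rw [this] at hg
        exact mul_left_cancel (a := x⁻¹ * z) (by rw [mul_one]; exact hg.symm)
      rw [if_pos ⟨rfl, rfl, rfl⟩, if_pos (Subtype.ext hκ)]
    · rw [if_neg hcond]
      by_cases hκ : κ = 1
      · -- the target quadruple `(x₀, y, y, z₀)` also produces this point, with value 1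
        have hval' := hc x₀ hx₀ y hy y hy z₀ hz₀
        change tokenFn c (x₀⁻¹ * y * y⁻¹ * z₀) = _ at hval'
        rw [if_pos ⟨rfl, rfl, rfl⟩] at hval'
        have : x₀⁻¹ * y * y⁻¹ * z₀ = x₀⁻¹ * z₀ * (κ : Equiv.Perm (Fin n)) := by
          rw [hκ, Subgroup.coe_one, mul_one]; group
        rw [this, hval, if_neg hcond] at hval'
        exact absurd hval' zero_ne_one
      · rw [if_neg hκ]
  have hsum := sum_coset_sign_mul_tokenFn a b ha hb hab c (x₀⁻¹ * z₀)
  simp_rw [hf, mul_ite, mul_one, mul_zero, Finset.sum_ite_eq', Finset.mem_univ, if_true] at hsum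
  have hunit : ((Equiv.Perm.sign (x₀⁻¹ * z₀ * ((1 : K) : Equiv.Perm (Fin n))) : ℤ) : ℂ) ≠ 0 := by
    rcases Int.units_eq_one_or (Equiv.Perm.sign (x₀⁻¹ * z₀ * ((1 : K) : Equiv.Perm (Fin n)))) with h1 | h1 <;>
      (rw [h1]; simp)
  exact hunit hsum


/-! ## Graded Neumann count at every level (after the sibling refutation of `LevelTwoBeatsCubes`)

The refuter of stmt-7612 landed `LevelTwoBeatsCubes.Negative.GradedNeumannCount`: for a triple
separated by a right- (left-) invariant `J`, `|X||Z| + |X|(|Y|-1) ≤ dim J`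
(`|X||Z| + (|Y|-1)|Z| ≤ dim J`), whence `|X||Y||Z| ≤ pD + p² - p³ ≤ (2/(3√3)) D^{3/2} + D/3`,
`p = min(|X|,|Z|)`, `D = dim J`.  Instantiated at `J = T_k` this supersedes the three walls above
(constant `0.385` instead of `1` in `V ≤ c·(dim T_k)^{3/2}`) at EVERY level `k`:
asymptotically in `n` (with `dim T_k = D_k(n) ≈ n^{2k}/k!` and
`budget_k(ε) ≈ ρ_k(ε) D_k^{1+ε/2}`, `ρ_k(ε) = ∑_{ν ⊢ k} (f^ν)^{2+ε}/(k!)^{1+ε/2}`), level `k` is DEAD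
whenever `0.385^{(2+ε)/3} ≤ ρ_k(ε)`: level 2 for `ε < 22.5`, level 3 for EVERY `ε`, level 4 for `ε < 2.51`,
5: `ε < 1.37`, 6: `1.17`, 7: `0.91`, 8: `0.74`, 9: `0.64`, 10: `0.58`, 12: `0.48`, 14: `0.41`
(`compute` table in NOTES; `ε_k ≈ 6/k`).  So ANY witness family for the crux has `k(ε) → ∞`
(roughly `k ≳ 6/ε`) — but since `ρ_k(ε) → 0` as `k → ∞` for fixed `ε` (Plancherel-typical
`f^ν ≈ √(k!) e^{-c√k}`), the graded Neumann count does NOT close the large-`k` window: no kill. -/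

/-- Graded Neumann count for `k`-token separation, `X`-slab: `|X||Z| + |X|(|Y|-1) ≤ dim T_k`. -/
theorem neumann_X {n k : ℕ} {X Y Z : Finset (Equiv.Perm (Fin n))} (h : Sep n k X Y Z)
    (hY : Y.Nonempty) (hZ : Z.Nonempty) :
    X.card * Z.card + X.card * (Y.card - 1) ≤ Module.finrank ℂ (tokenSpace n k) := by
  obtain ⟨y₁, hy₁⟩ := hY
  obtain ⟨z₁, hz₁⟩ := hZ
  refine Summit.MatrixMultiplication.MatrixMultiplication.Theorems.LevelTwoBeatsCubes.Negative.packing_X (tokenSpace n k) ?_ X Y Z ?_ hy₁ hz₁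
  · intro f hf g'
    have : (fun g => f (g * g')) = fun g => f (1 * g * g') := by simp only [one_mul]
    rw [this]; exact translate_mem_tokenSpace hf 1 g'
  · intro x₀ hx₀ z₀ hz₀
    obtain ⟨c, hc⟩ := h x₀ hx₀ z₀ hz₀
    refine ⟨tokenFn c, tokenFn_mem_tokenSpace c, fun x hx y hy y' hy' z hz => ?_⟩
    have hv := hc x hx y hy y' hy' z hz
    change tokenFn c (x⁻¹ * y * y'⁻¹ * z) = _ at hv
    constructor
    · intro hcond; rw [hv, if_pos hcond]
    · intro hcond; rw [hv, if_neg hcond]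

/-- Graded Neumann count for `k`-token separation, `Z`-slab: `|X||Z| + (|Y|-1)|Z| ≤ dim T_k`. -/
theorem neumann_Z {n k : ℕ} {X Y Z : Finset (Equiv.Perm (Fin n))} (h : Sep n k X Y Z)
    (hX : X.Nonempty) (hY : Y.Nonempty) :
    X.card * Z.card + (Y.card - 1) * Z.card ≤ Module.finrank ℂ (tokenSpace n k) := by
  obtain ⟨x₁, hx₁⟩ := hX
  obtain ⟨y₁, hy₁⟩ := hY
  refine Summit.MatrixMultiplication.MatrixMultiplication.Theorems.LevelTwoBeatsCubes.Negative.packing_Z (tokenSpace n k) ?_ X Y Z ?_ hx₁ hy₁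
  · intro f hf g'
    have : (fun g => f (g' * g)) = fun g => f (g' * g * 1) := by simp only [mul_one]
    rw [this]; exact translate_mem_tokenSpace hf g' 1
  · intro x₀ hx₀ z₀ hz₀
    obtain ⟨c, hc⟩ := h x₀ hx₀ z₀ hz₀
    refine ⟨tokenFn c, tokenFn_mem_tokenSpace c, fun x hx y hy y' hy' z hz => ?_⟩
    have hv := hc x hx y hy y' hy' z hz
    change tokenFn c (x⁻¹ * y * y'⁻¹ * z) = _ at hv
    constructor
    · intro hcond; rw [hv, if_pos hcond]
    · intro hcond; rw [hv, if_neg hcond]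

/-- **Cubic volume budget at every level**: if `B` dominates `p·dim T_k + p² - p³` for all `p`, then
every `k`-token separated triple has `|X||Y||Z| ≤ B` (graded Neumann + `vol_le` of the sibling file).
Asymptotically the least such `B` is `(2/(3√3)) (dim T_k)^{3/2} (1 + o(1))`. -/
theorem volume_le_of_cubic_budget {n k : ℕ} {X Y Z : Finset (Equiv.Perm (Fin n))} (h : Sep n k X Y Z)
    (B : ℕ) (hB : ∀ p : ℕ, p * Module.finrank ℂ (tokenSpace n k) + p ^ 2 ≤ p ^ 3 + B) :
    X.card * Y.card * Z.card ≤ B := by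
  classical
  rcases X.eq_empty_or_nonempty with hX | hX
  · simp [hX]
  rcases Y.eq_empty_or_nonempty with hY | hY
  · simp [hY]
  rcases Z.eq_empty_or_nonempty with hZ | hZ
  · simp [hZ]
  exact Summit.MatrixMultiplication.MatrixMultiplication.Theorems.LevelTwoBeatsCubes.Negative.vol_le X.card Y.card Z.card _ B hY.card_pos
    (neumann_X h hY hZ) (neumann_Z h hX hY) hB

end

end Summit.MatrixMultiplication.MatrixMultiplication.Cruxes.SnLevelDesigns.Disproof
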